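import Mathlib
import Summits.Ventures.PercRepro2.TwoSepGlue

/-!
# Gluing at a general separator, I: the closure lemmas and the far-pattern tools (blind cell
PercRepro2, mine-2 g47, 2026-08-29; `conjectures/MINE-2.md` M2-97)

Two vertex sets `W`, `W'` whose intersection is covered by the SEPARATOR `σ : ι → V` (any finite
family of vertices — a cut vertex, a 2-separator, a 3-separator, …), every open edge within one of
them.  The GLUE relation on `ι` is the reflexive–transitive closure of «joined inside `W` or inside
`W'`» (`glue`): a connection between two vertices of `W` runs inside `W` or leaves `W` at a
separator vertex `σ i`, moves to a glued separator vertex `σ j`, and returns inside `W`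
(`conn_sideG`); a connection from `r ∈ W` to a far vertex `u ∈ W'` off the separator enters the far
side at a separator vertex glued to one reached from `r` inside `W` (`conn_crossG`).  Both follow
from the closure argument of `RootCutSupport.conn_side` with the closed set `reachG ∪ reachG'`
(`reachG_of_conn`).  With `|ι| = 2` this is `TwoSepGlue.conn_side2` / `conn_cross2`, with `|ι| = 1`
the cut-vertex closure; the one-hop shape of the 2-separator lemmas is replaced by the closure,
which with three or more separator vertices is genuinely iterated.

The FAR PATTERN of a copy at the separator is the pair «connections inside the far side among the
separator vertices, connections from the separator vertices to the far mark» (`fpG`); the exact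
indicator `exactG`, its sum `sum_exactG`, the far-pattern kernel `farKG` of a pattern triple with its
nonnegativity and copy symmetries (`farCountG_swap12/23/13/cyc/cyc'`) are the general-separator
forms of the `TwoSepGlue` tools.  Own work; standard axioms.
-/

namespace Summit.Ventures.PercRepro2

open UnionCluster

namespace CovForm

namespace RootBridge

open OneTyped TypedA3 Untouched TypedFactor Separated

/-! ## The glue relation and the closure lemmas -/

section Sides

open Classical

variable {V : Type*} {E : Type*} {ι : Type*} (ends : E → Sym2 V)

/-- Two separator vertices are joined in one step when connected inside `W` or inside `W'`. -/
def sepStep (W W' : Set V) (σ : ι → V) (x : Config E) (i j : ι) : Prop :=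
  Conn ends (withinRestr ends W x) (σ i) (σ j) ∨ Conn ends (withinRestr ends W' x) (σ i) (σ j)

/-- The glue relation of the separator: the reflexive–transitive closure of `sepStep`. -/
def glue (W W' : Set V) (σ : ι → V) (x : Config E) (i j : ι) : Prop :=
  Relation.ReflTransGen (sepStep ends W W' σ x) i j

/-- A step is symmetric. -/
lemma sepStep_symm {W W' : Set V} {σ : ι → V} {x : Config E} {i j : ι}
    (h : sepStep ends W W' σ x i j) : sepStep ends W W' σ x j i := by
  unfold sepStep at h ⊢
  rcases h with h | h
  · exact Or.inl (conn_symm h)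
  · exact Or.inr (conn_symm h)

/-- The glue relation is reflexive. -/
lemma glue_refl (W W' : Set V) (σ : ι → V) (x : Config E) (i : ι) : glue ends W W' σ x i i :=
  Relation.ReflTransGen.refl

/-- The glue relation is transitive. -/
lemma glue_trans {W W' : Set V} {σ : ι → V} {x : Config E} {i j k : ι}
    (h : glue ends W W' σ x i j) (h' : glue ends W W' σ x j k) : glue ends W W' σ x i k :=
  Relation.ReflTransGen.trans h h'

/-- The glue relation is symmetric. -/
lemma glue_symm {W W' : Set V} {σ : ι → V} {x : Config E} {i j : ι}
    (h : glue ends W W' σ x i j) : glue ends W W' σ x j i := by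
  unfold glue at h ⊢
  induction h with
  | refl => exact Relation.ReflTransGen.refl
  | tail _ hbc ih => exact Relation.ReflTransGen.head (sepStep_symm ends hbc) ih

/-- A connection inside `W` between separator vertices glues them. -/
lemma glue_of_W {W W' : Set V} {σ : ι → V} {x : Config E} {i j : ι}
    (h : Conn ends (withinRestr ends W x) (σ i) (σ j)) : glue ends W W' σ x i j :=
  Relation.ReflTransGen.single (Or.inl h)

/-- A connection inside `W'` between separator vertices glues them. -/
lemma glue_of_W' {W W' : Set V} {σ : ι → V} {x : Config E} {i j : ι}
    (h : Conn ends (withinRestr ends W' x) (σ i) (σ j)) : glue ends W W' σ x i j :=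
  Relation.ReflTransGen.single (Or.inr h)

/-- Glued separator vertices are connected in the configuration. -/
lemma conn_of_glue {W W' : Set V} {σ : ι → V} {x : Config E} {i j : ι}
    (h : glue ends W W' σ x i j) : Conn ends x (σ i) (σ j) := by
  unfold glue at h
  induction h with
  | refl => exact conn_refl _ _ _
  | tail _ hbc ih =>
    refine conn_trans ih ?_
    rcases hbc with hbc | hbc
    · exact conn_mono (withinRestr_le ends W x) hbc
    · exact conn_mono (withinRestr_le ends W' x) hbc

/-- The vertices reached from `r` inside `W`, directly or through the glued separator. -/
def reachG (W W' : Set V) (σ : ι → V) (x : Config E) (r t : V) : Prop :=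
  Conn ends (withinRestr ends W x) r t ∨
    ∃ i j, Conn ends (withinRestr ends W x) (σ i) r ∧ glue ends W W' σ x i j ∧
      Conn ends (withinRestr ends W x) (σ j) t

/-- The vertices of the far side reached from `r ∈ W`: through the glued separator. -/
def reachG' (W W' : Set V) (σ : ι → V) (x : Config E) (r t : V) : Prop :=
  ∃ i j, Conn ends (withinRestr ends W x) (σ i) r ∧ glue ends W W' σ x i j ∧
    Conn ends (withinRestr ends W' x) (σ j) t

/-- `reachG` is closed under steps inside `W`. -/
lemma reachG_trans {W W' : Set V} {σ : ι → V} {x : Config E} {r t t' : V}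
    (h : reachG ends W W' σ x r t) (h' : Conn ends (withinRestr ends W x) t t') :
    reachG ends W W' σ x r t' := by
  unfold reachG at h ⊢
  rcases h with h | ⟨i, j, h1, h2, h3⟩
  · exact Or.inl (conn_trans h h')
  · exact Or.inr ⟨i, j, h1, h2, conn_trans h3 h'⟩

/-- `reachG'` is closed under steps inside `W'`. -/
lemma reachG'_trans {W W' : Set V} {σ : ι → V} {x : Config E} {r t t' : V}
    (h : reachG' ends W W' σ x r t) (h' : Conn ends (withinRestr ends W' x) t t') :
    reachG' ends W W' σ x r t' := by
  obtain ⟨i, j, h1, h2, h3⟩ := h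
  exact ⟨i, j, h1, h2, conn_trans h3 h'⟩

/-- At a separator vertex the two descriptions agree: `reachG → reachG'`. -/
lemma reachG'_of_reachG_sep {W W' : Set V} {σ : ι → V} {x : Config E} {r : V} {i : ι}
    (h : reachG ends W W' σ x r (σ i)) : reachG' ends W W' σ x r (σ i) := by
  unfold reachG at h
  rcases h with h | ⟨j, k, h1, h2, h3⟩
  · exact ⟨i, i, conn_symm h, glue_refl ends W W' σ x i, conn_refl _ _ _⟩
  · exact ⟨j, i, h1, glue_trans ends h2 (glue_of_W ends h3), conn_refl _ _ _⟩

/-- At a separator vertex the two descriptions agree: `reachG' → reachG`. -/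
lemma reachG_of_reachG'_sep {W W' : Set V} {σ : ι → V} {x : Config E} {r : V} {i : ι}
    (h : reachG' ends W W' σ x r (σ i)) : reachG ends W W' σ x r (σ i) := by
  obtain ⟨j, k, h1, h2, h3⟩ := h
  exact Or.inr ⟨j, i, h1, glue_trans ends h2 (glue_of_W' ends h3), conn_refl _ _ _⟩

/-- **The closure argument at a separator**: everything connected to `r ∈ W` is reached inside
`W` (through the glued separator at most) or lies on the far side, entered through the glued
separator. -/
theorem reachG_of_conn {W W' : Set V} {σ : ι → V} {x : Config E}
    (hx : ∀ e, x e = true → e ∈ within ends W ∨ e ∈ within ends W')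
    (hcap : ∀ t, t ∈ W → t ∈ W' → ∃ i, σ i = t) {r u : V} (hr : r ∈ W)
    (h : Conn ends x r u) :
    (u ∈ W ∧ reachG ends W W' σ x r u) ∨ (u ∈ W' ∧ reachG' ends W W' σ x r u) := by
  refine mem_of_conn_of_closed (ends := ends) (ω := x)
    (S := {t | (t ∈ W ∧ reachG ends W W' σ x r t) ∨ (t ∈ W' ∧ reachG' ends W W' σ x r t)})
    ?_ (Or.inl ⟨hr, Or.inl (conn_refl _ _ _)⟩) h
  rintro t ht t' htt'
  obtain ⟨_, e, he, hends⟩ := openGraph_adj.1 htt'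
  rcases hx e he with hw | hw'
  · have hmem := ends_mem_of_within ends hw hends
    have he' : withinRestr ends W x e = true := by simp [withinRestr, hw, he]
    have hstep : Conn ends (withinRestr ends W x) t t' := conn_of_openAdj ⟨e, he', hends⟩
    have hA : reachG ends W W' σ x r t := by
      rcases ht with ⟨_, hA⟩ | ⟨htW', hB⟩
      · exact hA
      · obtain ⟨i, rfl⟩ := hcap t hmem.1 htW'
        exact reachG_of_reachG'_sep ends hB
    exact Or.inl ⟨hmem.2, reachG_trans ends hA hstep⟩
  · have hmem := ends_mem_of_within ends hw' hends
    have he' : withinRestr ends W' x e = true := by simp [withinRestr, hw', he]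
    have hstep : Conn ends (withinRestr ends W' x) t t' := conn_of_openAdj ⟨e, he', hends⟩
    have hB : reachG' ends W W' σ x r t := by
      rcases ht with ⟨htW, hA⟩ | ⟨_, hB⟩
      · obtain ⟨i, rfl⟩ := hcap t htW hmem.1
        exact reachG'_of_reachG_sep ends hA
      · exact hB
    exact Or.inr ⟨hmem.2, reachG'_trans ends hB hstep⟩

/-- **Side closure at a separator**: for `r, u ∈ W` the connection `r ↔ u` runs inside `W`, or
inside `W` from `r` to a separator vertex, along the glue relation to another, and inside `W` to
`u`. -/
theorem conn_sideG {W W' : Set V} {σ : ι → V} {x : Config E}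
    (hx : ∀ e, x e = true → e ∈ within ends W ∨ e ∈ within ends W')
    (hcap : ∀ t, t ∈ W → t ∈ W' → ∃ i, σ i = t) {r u : V} (hr : r ∈ W) (hu : u ∈ W) :
    Conn ends x r u ↔ reachG ends W W' σ x r u := by
  constructor
  · intro h
    rcases reachG_of_conn ends hx hcap hr h with ⟨_, hA⟩ | ⟨huW', hB⟩
    · exact hA
    · obtain ⟨i, rfl⟩ := hcap u hu huW'
      exact reachG_of_reachG'_sep ends hB
  · intro h
    have hW := withinRestr_le ends W x
    unfold reachG at h
    rcases h with h | ⟨i, j, h1, h2, h3⟩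
    · exact conn_mono hW h
    · exact conn_trans (conn_mono hW (conn_symm h1))
        (conn_trans (conn_of_glue ends h2) (conn_mono hW h3))

/-- **Crossing a separator**: a connection from `r ∈ W` to a far vertex `u ∈ W'` off the
separator is a connection inside `W` to a separator vertex, the glue relation to another, and a
connection inside `W'` from there to `u`. -/
theorem conn_crossG {W W' : Set V} {σ : ι → V} {x : Config E}
    (hx : ∀ e, x e = true → e ∈ within ends W ∨ e ∈ within ends W')
    (hcap : ∀ t, t ∈ W → t ∈ W' → ∃ i, σ i = t) {r u : V} (hr : r ∈ W) (hu : u ∈ W')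
    (hu' : ∀ i, σ i ≠ u) :
    Conn ends x r u ↔ reachG' ends W W' σ x r u := by
  constructor
  · intro h
    rcases reachG_of_conn ends hx hcap hr h with ⟨huW, _⟩ | ⟨_, hB⟩
    · obtain ⟨i, hi⟩ := hcap u huW hu
      exact absurd hi (hu' i)
    · exact hB
  · rintro ⟨i, j, h1, h2, h3⟩
    exact conn_trans (conn_mono (withinRestr_le ends W x) (conn_symm h1))
      (conn_trans (conn_of_glue ends h2) (conn_mono (withinRestr_le ends W' x) h3))

end Sides

/-! ## Far patterns at a separator and the exact-pattern indicators -/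

section Patterns

open Classical

variable {V : Type*} {E : Type*} {ι : Type*} [Fintype ι] (ends : E → Sym2 V)

/-- A far pattern at a separator indexed by `ι`: the connections inside the far side among the
separator vertices, and from each separator vertex to the far mark. -/
abbrev FPG (ι : Type*) := (ι → ι → Bool) × (ι → Bool)

/-- The far pattern of a configuration (read on a far-side restriction). -/
noncomputable def fpG (σ : ι → V) (m : V) (y : Config E) : FPG ι :=
  (fun i j => decide (Conn ends y (σ i) (σ j)), fun i => decide (Conn ends y (σ i) m))

/-- The exact-pattern indicator. -/
noncomputable def exactG (p q : FPG ι) : ℤ := if p = q then 1 else 0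

/-- The indicator is nonnegative. -/
lemma exactG_nonneg (p q : FPG ι) : 0 ≤ exactG p q := by
  unfold exactG
  split_ifs <;> simp

/-- A pattern triple (one far pattern per copy). -/
abbrev Pat3G (ι : Type*) := FPG ι × FPG ι × FPG ι

/-- Summing a function against the exact indicators of a pattern triple picks the triple. -/
lemma sum_exactG [DecidableEq ι] (f : Pat3G ι → ℤ) (q : Pat3G ι) :
    (∑ p : Pat3G ι, exactG p.1 q.1 * exactG p.2.1 q.2.1 * exactG p.2.2 q.2.2 * f p) = f q := by
  rw [Finset.sum_eq_single q]
  · simp [exactG]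
  · intro p _ hpq
    by_cases h1 : p.1 = q.1
    · by_cases h2 : p.2.1 = q.2.1
      · by_cases h3 : p.2.2 = q.2.2
        · exact absurd (Prod.ext h1 (Prod.ext h2 h3)) hpq
        · simp [exactG, h3]
      · simp [exactG, h2]
    · simp [exactG, h1]
  · intro h
    exact absurd (Finset.mem_univ q) h

end Patterns

/-! ## The far-pattern kernels and their copy symmetries -/

section FarCounts

open Classical

variable {V : Type*} {E : Type*} {ι : Type*} [Fintype ι] [Fintype E] [DecidableEq E]
  {R : Type*} [Field R] [LinearOrder R] [IsStrictOrderedRing R]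
variable (ends : E → Sym2 V) (σ : ι → V) (m : V) (VL : Set V)

/-- The far-side kernel of the exact pattern triple `p`: each copy's far pattern, read on the far
restriction to `VL`, must be the prescribed one. -/
noncomputable def farKG (p : Pat3G ι) : Config E → Config E → Config E → R :=
  fun x y w => ((exactG p.1 (fpG ends σ m (withinRestr ends VL x)) *
    exactG p.2.1 (fpG ends σ m (withinRestr ends VL y)) *
    exactG p.2.2 (fpG ends σ m (withinRestr ends VL w)) : ℤ) : R)

/-- The far-pattern counts are nonnegative. -/
lemma farCountG_nonneg (A : Finset E) (z : Config E) (τ : E → ℕ) (p : Pat3G ι) :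
    (0 : R) ≤ typedCount A z τ (farKG ends σ m VL p) := by
  refine typedCount_nonneg_of_nonneg _ _ _ fun x y w => ?_
  unfold farKG
  push_cast
  refine mul_nonneg (mul_nonneg ?_ ?_) ?_ <;> exact_mod_cast exactG_nonneg _ _

omit [LinearOrder R] [IsStrictOrderedRing R] in
/-- Copy symmetry of the far-pattern counts: the first two copies. -/
lemma farCountG_swap12 (A : Finset E) (z : Config E) (τ : E → ℕ) (p : Pat3G ι) :
    typedCount A z τ (farKG ends σ m VL (p.2.1, p.1, p.2.2) : Config E → Config E → Config E → R) =
      typedCount A z τ (farKG ends σ m VL p) := by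
  rw [← typedCount_swap12 A z τ (farKG ends σ m VL p)]
  exact typedCount_congr' _ _ _ _ _ fun x y w => by unfold farKG; push_cast; ring

omit [LinearOrder R] [IsStrictOrderedRing R] in
/-- Copy symmetry of the far-pattern counts: the last two copies (types in `{1, 2}`). -/
lemma farCountG_swap23 (A : Finset E) (z : Config E) (τ : E → ℕ) (hτ : ∀ e ∈ A, τ e = 1 ∨ τ e = 2)
    (p : Pat3G ι) :
    typedCount A z τ (farKG ends σ m VL (p.1, p.2.2, p.2.1) : Config E → Config E → Config E → R) =
      typedCount A z τ (farKG ends σ m VL p) := by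
  rw [← typedCount_swap23 A z τ hτ (farKG ends σ m VL p)]
  exact typedCount_congr' _ _ _ _ _ fun x y w => by unfold farKG; push_cast; ring

omit [LinearOrder R] [IsStrictOrderedRing R] in
/-- Copy symmetry of the far-pattern counts: the first and third copies (types in `{1, 2}`). -/
lemma farCountG_swap13 (A : Finset E) (z : Config E) (τ : E → ℕ) (hτ : ∀ e ∈ A, τ e = 1 ∨ τ e = 2)
    (p : Pat3G ι) :
    typedCount A z τ (farKG ends σ m VL (p.2.2, p.2.1, p.1) : Config E → Config E → Config E → R) =
      typedCount A z τ (farKG ends σ m VL p) := by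
  rw [← typedCount_swap13 A z τ hτ (farKG ends σ m VL p)]
  exact typedCount_congr' _ _ _ _ _ fun x y w => by unfold farKG; push_cast; ring

omit [LinearOrder R] [IsStrictOrderedRing R] in
/-- Copy symmetry of the far-pattern counts: the cyclic shift `(p₁, p₂, p₃) ↦ (p₂, p₃, p₁)`. -/
lemma farCountG_cyc (A : Finset E) (z : Config E) (τ : E → ℕ) (hτ : ∀ e ∈ A, τ e = 1 ∨ τ e = 2)
    (p : Pat3G ι) :
    typedCount A z τ (farKG ends σ m VL (p.2.1, p.2.2, p.1) : Config E → Config E → Config E → R) =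
      typedCount A z τ (farKG ends σ m VL p) := by
  have h1 := typedCount_swap12 A z τ (fun x y w => farKG ends σ m VL p w y x : Config E →
    Config E → Config E → R)
  have h2 := typedCount_swap13 A z τ hτ (farKG ends σ m VL p : Config E → Config E → Config E → R)
  rw [← h2, ← h1]
  exact typedCount_congr' _ _ _ _ _ fun x y w => by unfold farKG; push_cast; ring

omit [LinearOrder R] [IsStrictOrderedRing R] in
/-- Copy symmetry of the far-pattern counts: the cyclic shift `(p₁, p₂, p₃) ↦ (p₃, p₁, p₂)`. -/
lemma farCountG_cyc' (A : Finset E) (z : Config E) (τ : E → ℕ) (hτ : ∀ e ∈ A, τ e = 1 ∨ τ e = 2)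
    (p : Pat3G ι) :
    typedCount A z τ (farKG ends σ m VL (p.2.2, p.1, p.2.1) : Config E → Config E → Config E → R) =
      typedCount A z τ (farKG ends σ m VL p) := by
  have h1 := typedCount_swap12 A z τ (fun x y w => farKG ends σ m VL p x w y : Config E →
    Config E → Config E → R)
  have h2 := typedCount_swap23 A z τ hτ (farKG ends σ m VL p : Config E → Config E → Config E → R)
  rw [← h2, ← h1]
  exact typedCount_congr' _ _ _ _ _ fun x y w => by unfold farKG; push_cast; ring

end FarCounts

end RootBridge

end CovForm

end Summit.Ventures.PercRepro2
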